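import Summits.KontsevichZagierPeriods.KontsevichZagierPeriods.Theorems.DihedralNormalForm.Negative.Core
import Literature.Barriers.KontsevichZagierPeriods.AlgebraicPrimitivesObstruction

/-!
# `DihedralNormalForm` (stmt-KontsevichZagierPeriods-3912): negative side, III — rules (3) and (2) are load-bearing

Landed copy of §4–§5 of the crux work file `Cruxes/DihedralNormalForm/Disproof.lean` (companion of `Core.lean`).

* §4 RULE (3): the dimension-graded evaluation `evalDim d : FormalRep →+ ℝ` kills the sub-calculus
  generated by the additivity moves and changes of variables (`relationsWithoutNL_le_ker_evalDim`)
  and the word closure in degree `1`, while `evalDim 1 [Δ₁, 1] = 1`: the crux with `relations`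
  replaced by that sub-calculus is false (`dihedralNormalForm_false_without_newtonLeibniz`); the
  same witness kills the weight-homogeneous strengthening at `k = 1` (`not_cruxHomogeneousAt_one`).
* §5 RULE (2): the witness `letterRep = [Δ₂, 1/(1-t₁)]` (genus-zero, value `1`) and
  `no_semialgebraic_primitive_letter` — neither letter `1/(1-t)`, `1/t` has a `ℚ`-semialgebraic
  primitive (from the barrier file `AlgebraicPrimitivesObstruction`), so the direct Newton–Leibniz
  fold of the witness along its last coordinate does not exist; the global statement "the crux
  fails inside `closure(1a ∪ 1b ∪ 3)`" is a theorem on paper (work file §5) whose Lean proof waits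
  for a two-coordinate slice API.

Source for the rules: M. Kontsevich, D. Zagier, *Periods* (2001), §1.2; for the missing
primitives: J. Ayoub, Ann. Math. 181 (2015), Rem. 1.2. -/

noncomputable section

open MeasureTheory Set
open Literature.NumberTheory.Transcendental

namespace Summit.KontsevichZagierPeriods.DihedralNormalForm.Negative

open Summit.KontsevichZagierPeriods.KontsevichZagierPeriods.Theses.LinRedNormalForm
  (DihedralNormalForm)

/-! ## §4 Rule (3) is load-bearing, certified: the dimension-graded evaluation `evalDim`

(Generation 3; re-establishes generation 1's lost `dihedralNormalForm_false_without_newtonLeibniz`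
with a simpler witness.)  The additivity moves (1a), (1b) and the change of variables (2) relate
representations of ONE dimension `n`; only Newton–Leibniz (3) changes the dimension.  Hence for
every `d` the graded evaluation `evalDim d` (sum of the values of the dimension-`d` generators) is
an additive invariant of the sub-calculus generated by (1a), (1b), (2).  The witness is the
simplest genus-zero representation of positive dimension, `[Δ₁, 1]` (`P = 1`, all exponents `0`,
value `1`): a word representation of length `1` has value `0` (`value_word_one`), so
`evalDim 1 ([Δ₁,1] − m) = 1 ≠ 0` for every `m` in the word closure.  ANY proof of the crux uses
rule (3) already at `k = 1`; combined with §2 (the top word length `k` must be produced) the moves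
budget of a proof is: at least one Newton–Leibniz descent per dimension `1 … k` that is removed,
and none can be traded for additivity or changes of variables. -/

/-- Dimension-graded evaluation: the additive map sending a generator `[r]` of dimension `n` to
`value r` if `n = d` and to `0` otherwise. -/
def evalDim (d : ℕ) : KZ.FormalRep →+ ℝ :=
  FreeAbelianGroup.lift fun p => if p.1 = d then p.2.value else 0

/-- `evalDim d [r]` is `value r` in dimension `d` and `0` otherwise. -/
@[simp] theorem evalDim_of (d : ℕ) {n : ℕ} (r : KZ.IntegralRep n) :
    evalDim d (KZ.of r) = if n = d then r.value else 0 := by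
  simp [evalDim, KZ.of]

/-- The sub-calculus WITHOUT Newton–Leibniz: the subgroup generated by moves (1a), (1b), (2).
(Kontsevich–Zagier 2001, §1.2) -/
def relationsWithoutNL : AddSubgroup KZ.FormalRep :=
  AddSubgroup.closure (KZ.domainAddRel ∪ KZ.integrandAddRel ∪ KZ.changeOfVariablesRel)

/-- The sub-calculus without Newton–Leibniz is part of `KZ.relations`. -/
theorem relationsWithoutNL_le_relations : relationsWithoutNL ≤ KZ.relations :=
  AddSubgroup.closure_mono subset_union_left

/-- `evalDim` of a three-term move shape in one dimension. -/
theorem evalDim_three {n d : ℕ} (r r₁ r₂ : KZ.IntegralRep n) :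
    evalDim d (KZ.of r - KZ.of r₁ - KZ.of r₂) =
      if n = d then KZ.eval (KZ.of r - KZ.of r₁ - KZ.of r₂) else 0 := by
  by_cases h : n = d <;> simp [h]

/-- `evalDim` of a two-term move shape in one dimension. -/
theorem evalDim_two {n d : ℕ} (r r' : KZ.IntegralRep n) :
    evalDim d (KZ.of r - KZ.of r') = if n = d then KZ.eval (KZ.of r - KZ.of r') else 0 := by
  by_cases h : n = d <;> simp [h]

/-- **`evalDim d` is an invariant of the sub-calculus (1a) + (1b) + (2)**: each of these moves
relates representations of a single dimension and evaluates to `0` (soundness), so its graded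
evaluation vanishes in every degree. -/
theorem relationsWithoutNL_le_ker_evalDim (d : ℕ) : relationsWithoutNL ≤ (evalDim d).ker := by
  refine (AddSubgroup.closure_le _).mpr ?_
  rintro c ((hc | hc) | hc)
  · have h0 : KZ.eval c = 0 := KZ.eval_eq_zero_of_mem_domainAddRel_holds hc
    obtain ⟨n, r, r₁, r₂, -, -, -, -, rfl⟩ := hc
    rw [SetLike.mem_coe, AddMonoidHom.mem_ker, evalDim_three, h0, ite_self]
  · have h0 : KZ.eval c = 0 := KZ.eval_eq_zero_of_mem_integrandAddRel_holds hc
    obtain ⟨n, r, r₁, r₂, -, -, -, rfl⟩ := hc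
    rw [SetLike.mem_coe, AddMonoidHom.mem_ker, evalDim_three, h0, ite_self]
  · have h0 : KZ.eval c = 0 := KZ.eval_eq_zero_of_mem_changeOfVariablesRel_holds hc
    obtain ⟨n, r, r', Φ, Φ', -, -, -, -, -, rfl⟩ := hc
    rw [SetLike.mem_coe, AddMonoidHom.mem_ker, evalDim_two, h0, ite_self]

/-- In degree `1` the graded evaluation kills the whole word closure: word representations of
length `1` have value `0` (`value_word_one`), the others have the wrong dimension. -/
theorem evalDim_one_eq_zero_of_mem_closure {m : KZ.FormalRep}
    (hm : m ∈ AddSubgroup.closure wordRepSet) : evalDim 1 m = 0 := by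
  induction hm using AddSubgroup.closure_induction with
  | mem x hx =>
    obtain ⟨w, ε, q, s, hdom, hint, rfl⟩ := hx
    rw [evalDim_of]
    split_ifs with h
    · subst h
      exact value_word_one hdom hint
    · rfl
  | zero => simp
  | add x y _ _ hx hy => simp [hx, hy]
  | neg x _ hx => simp [hx]

/-- The Lebesgue measure of the open interval `Δ₁ = (0,1) ⊂ ℝ¹` is `1`. -/
theorem volume_simplex_one : volume (simplex 1) = 1 := by
  set e : (Fin 1 → ℝ) ≃ᵐ ℝ := MeasurableEquiv.funUnique (Fin 1) ℝ with he
  have hmp : MeasurePreserving e volume volume := volume_preserving_funUnique (Fin 1) ℝ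
  have hpre : e ⁻¹' Ioo (0 : ℝ) 1 = simplex 1 := by
    rw [simplex_one]; ext t; simp [he, MeasurableEquiv.funUnique]
  rw [← hpre, hmp.measure_preimage measurableSet_Ioo.nullMeasurableSet, Real.volume_Ioo]
  simp

/-- **The witness `[Δ₁, 1]`**: the open interval with the constant integrand `1` (KZ-literal data
`1/1`). -/
def oneRep : KZ.IntegralRep 1 :=
  KZ.IntegralRep.ofRational (simplex 1) 1 1 (KZ.isSemialgebraic_openOrderedSimplex 1)
    (fun x _ => by simp)
    (by
      have h : (fun x : Fin 1 → ℝ => MvPolynomial.aeval x (1 : MvPolynomial (Fin 1) ℚ) /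
          MvPolynomial.aeval x (1 : MvPolynomial (Fin 1) ℚ)) = fun _ => (1 : ℝ) := by
        funext x; simp
      rw [h]
      exact integrableOn_const (by rw [volume_simplex_one]; simp))

/-- The domain of `[Δ₁, 1]`. -/
theorem oneRep_domain : oneRep.domain = simplex 1 := rfl

/-- The integrand of `[Δ₁, 1]` is the constant `1`. -/
theorem oneRep_integrand (x : Fin 1 → ℝ) : oneRep.integrand x = 1 := by
  simp [oneRep]

/-- `value [Δ₁, 1] = 1`. -/
theorem oneRep_value : oneRep.value = 1 := by
  rw [KZ.IntegralRep.value, oneRep_domain]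
  have h : (fun x => oneRep.integrand x) = fun _ => (1 : ℝ) := funext oneRep_integrand
  rw [h, setIntegral_const, measureReal_def, volume_simplex_one]
  simp

/-- `[Δ₁, 1]` has the genus-zero shape of the crux (`P = 1`, `a = b = c = 0`). -/
theorem isGenusZero_oneRep : IsGenusZero oneRep := by
  refine ⟨1, fun _ _ => 0, fun _ => 0, fun _ => 0, rfl, ?_⟩
  intro t _
  rw [oneRep_integrand]
  simp [gzIntegrand]

/-- **The crux WITHOUT rule (3)**: `KZ.relations` replaced by the subgroup generated by the
additivity and change-of-variables moves only. -/
def CruxWithoutNewtonLeibniz : Prop :=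
  ∀ (k : ℕ) (r : KZ.IntegralRep k), IsGenusZero r →
    ∃ m ∈ AddSubgroup.closure wordRepSet, KZ.of r - m ∈ relationsWithoutNL

/-- **Rule (3) is load-bearing (any proof of the crux must use Newton–Leibniz).** The crux with
`relations` replaced by the sub-calculus (1a)+(1b)+(2) is FALSE: `evalDim 1` vanishes on that
sub-calculus and on the word closure, but `evalDim 1 [Δ₁, 1] = 1`. The same witness shows that no
chain staying in dimensions `≠ 1` after leaving `[Δ₁,1]` by non-NL moves can exist: the first
move that changes `evalDim 1` is a Newton–Leibniz move out of (or into) dimension `1`. -/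
theorem dihedralNormalForm_false_without_newtonLeibniz : ¬ CruxWithoutNewtonLeibniz := by
  intro h
  obtain ⟨m, hm, hrel⟩ := h 1 oneRep isGenusZero_oneRep
  have h1 : evalDim 1 (KZ.of oneRep - m) = 0 :=
    (AddMonoidHom.mem_ker).1 (relationsWithoutNL_le_ker_evalDim 1 hrel)
  rw [map_sub, evalDim_of, if_pos rfl, oneRep_value, evalDim_one_eq_zero_of_mem_closure hm] at h1
  norm_num at h1

/-- **The weight-homogeneous strengthening at `k = 1` (re-proof of generation 1's lost theorem):**
"words of length EXACTLY `k`" is false at `k = 1` — every word representation of length `1` has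
value `0`, while `[Δ₁, 1]` has value `1`; soundness. -/
def CruxHomogeneousAt (k : ℕ) : Prop :=
  ∀ (r : KZ.IntegralRep k), IsGenusZero r →
    ∃ m ∈ AddSubgroup.closure {x : KZ.FormalRep | ∃ (ε : Fin k → Bool) (q : ℚ)
        (s : KZ.IntegralRep k), s.domain = simplex k ∧
        EqOn s.integrand (fun t => (q : ℝ) * ∏ i, if ε i then 1 / (1 - t i) else 1 / t i)
          s.domain ∧ x = KZ.of s},
      KZ.of r - m ∈ KZ.relations

/-- **The weight-homogeneous strengthening fails at `k = 1`.** -/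
theorem not_cruxHomogeneousAt_one : ¬ CruxHomogeneousAt 1 := by
  intro h
  obtain ⟨m, hm, hrel⟩ := h oneRep isGenusZero_oneRep
  have hm0 : KZ.eval m = 0 := by
    clear hrel
    induction hm using AddSubgroup.closure_induction with
    | mem x hx =>
      obtain ⟨ε, q, s, hdom, hint, rfl⟩ := hx
      rw [KZ.eval_of]
      exact value_word_one hdom hint
    | zero => simp
    | add x y _ _ hx hy => simp [hx, hy]
    | neg x _ hx => simp [hx]
  have h0 : KZ.eval (KZ.of oneRep - m) = 0 :=
    (AddMonoidHom.mem_ker).1 (KZ.relations_le_ker_eval_holds hrel)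
  rw [map_sub, KZ.eval_of, oneRep_value, hm0] at h0
  norm_num at h0


/-! ## §5 Rule (2): the witness `[Δ₂, 1/(1-t₁)]` and the letters' missing primitives

Rule (3) is typed along `Fin.last n`; without rule (2) the coordinate system is rigid.  The
genus-zero representation `r_L = [Δ₂, 1/(1-t₁)]` (value `1`) closes WITH rule (2) in four moves
(one transposition of coordinates — an element of `KZ.permRel ⊆ changeOfVariablesRel` — then
closing null faces, one Newton–Leibniz move with the rational primitive `y₁/(1-y₀)`, and a last
Newton–Leibniz move to `[pt, 1]`), and is NOT congruent to the word closure inside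
`closure(1a ∪ 1b ∪ 3)` (theorem on paper: push-forward of `f·λ|_σ` to the first two coordinates
modulo low-dimensional Newton–Leibniz differences; the word side is `1/x₀`-homogeneous and drops
out; the contradiction is the simple-pole descent of the barrier file — see the crux work file
`Cruxes/DihedralNormalForm/Disproof.lean` §5 for the full argument and the list of API missing for
a Lean proof).  Certified here: the witness with its genus-zero shape, and the one-function case of
the elimination step — neither letter `1/(1-t)`, `1/t` has a `ℚ`-semialgebraic primitive, so in
particular the direct Newton–Leibniz fold of `r_L` along its last coordinate does not exist. -/

/-- **No `ℚ`-semialgebraic primitive of a letter.** Neither `1/(1-t)` nor `1/t` has a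
`ℚ`-semialgebraic primitive on `[0,1]` (derivative on `(0,1)`): the one-function case of the
elimination step above, and the reason the direct Newton–Leibniz fold of `[Δ₂, 1/(1-t₁)]` along
its last coordinate does not exist (its fibrewise primitive would be `-log(1-t₁) + C(t₀)`).
Proof: steps (A)–(C) of the barrier file (`NoSemialgPrimKernel.exists_ne_zero_evalEval_eq_zero`,
`NoSemialgPrimKernel.eq_zero_of_evalEval_eq_zero` with the simple pole at `x₀ = 1`, resp. `0`). -/
theorem no_semialgebraic_primitive_letter (ε : Bool) :
    ¬ ∃ F : (Fin 1 → ℝ) → ℝ, IsSemialgebraicFunOn ℚ {x | x 0 ∈ Icc (0 : ℝ) 1} F ∧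
      ∀ t ∈ Ioo (0 : ℝ) 1,
        HasDerivAt (fun s : ℝ => F (fun _ => s)) (if ε then 1 / (1 - t) else 1 / t) t := by
  rintro ⟨F, hF, hderiv⟩
  obtain ⟨P, hP0, hPv⟩ :=
    Literature.Barriers.KontsevichZagierPeriods.KZ.NoSemialgPrimKernel.exists_ne_zero_evalEval_eq_zero hF
  -- the pole `x₀` and the data `V`, `N` of step (C): `((X - x₀)·V)·g' = N`
  let x₀ : ℝ := if ε then 1 else 0
  let V : Polynomial ℝ := if ε then Polynomial.C (-1) else Polynomial.C 1
  have hV : V.eval x₀ ≠ 0 := by cases ε <;> simp [V, x₀]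
  have hN : (Polynomial.C (1 : ℝ)).eval x₀ ≠ 0 := by simp
  have hDN : ∀ t ∈ Ioo (0 : ℝ) 1, ((Polynomial.X - Polynomial.C x₀) * V).eval t *
      (if ε then 1 / (1 - t) else 1 / t) = (Polynomial.C (1 : ℝ)).eval t := by
    intro t ht
    have h0 : t ≠ 0 := ht.1.ne'
    have h1 : (1 : ℝ) - t ≠ 0 := by have := ht.2; intro h; linarith
    cases ε
    · simp only [V, x₀, Bool.false_eq_true, if_false, Polynomial.eval_mul, Polynomial.eval_sub,
        Polynomial.eval_X, Polynomial.eval_C]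
      field_simp
      ring
    · simp only [V, x₀, if_true, Polynomial.eval_mul, Polynomial.eval_sub, Polynomial.eval_X,
        Polynomial.eval_C]
      field_simp
      ring
  exact hP0 (Literature.Barriers.KontsevichZagierPeriods.KZ.NoSemialgPrimKernel.eq_zero_of_evalEval_eq_zero
    (G := fun s : ℝ => F fun _ => s) hderiv hDN hV hN P.natDegree P le_rfl
    (fun t ht => hPv t (Ioo_subset_Icc_self ht)))

/-- `1/(1-t₁)` is dominated on `Δ₂` by the `ζ(2)` integrand `1/(t₀(1-t₁))` (as `t₀ < 1`), hence
absolutely integrable there. -/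
theorem integrableOn_one_div_one_sub : IntegrableOn (fun t : Fin 2 → ℝ => 1 / (1 - t 1)) (simplex 2) := by
  have hg : IntegrableOn zeta2Rep.integrand (simplex 2) := zeta2Rep.integrableOn
  refine Integrable.mono' hg ?_ ?_
  · have hm : Measurable fun t : Fin 2 → ℝ => 1 / (1 - t 1) :=
      (measurable_const.sub (measurable_pi_apply 1)).const_div 1
    exact hm.aestronglyMeasurable
  · rw [show simplex 2 = KZ.openOrderedSimplex 2 from rfl,
      ae_restrict_iff' (KZ.measurableSet_openOrderedSimplex 2)]
    refine ae_of_all _ fun t ht => ?_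
    obtain ⟨h0, h1, -⟩ := ht
    have ht0 : 0 < t 0 := h0 0
    have ht0' : t 0 < 1 := h1 0
    have ht1 : 0 < 1 - t 1 := by linarith [h1 1]
    rw [zeta2Rep_integrand, Real.norm_eq_abs, abs_of_pos (by positivity)]
    rw [div_mul_div_comm, one_mul, le_div_iff₀ (by positivity), div_mul_eq_mul_div, one_mul,
      div_le_iff₀ ht1]
    nlinarith

/-- **The witness `r_L = [Δ₂, 1/(1-t₁)]`** (KZ-literal data `1/(1 - X₁)`; value `1`). -/
def letterRep : KZ.IntegralRep 2 :=
  KZ.IntegralRep.ofRational (simplex 2) 1 (1 - MvPolynomial.X 1) (KZ.isSemialgebraic_openOrderedSimplex 2)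
    (fun t ht => by
      have := ht.2.1 1
      simp only [map_sub, map_one, MvPolynomial.aeval_X, ne_eq]
      linarith)
    (by
      refine integrableOn_one_div_one_sub.congr_fun (fun t _ => ?_) (KZ.measurableSet_openOrderedSimplex 2)
      simp)

/-- The domain of `r_L`. -/
theorem letterRep_domain : letterRep.domain = simplex 2 := rfl

/-- The integrand of `r_L` is `1/(1-t₁)`. -/
theorem letterRep_integrand (t : Fin 2 → ℝ) : letterRep.integrand t = 1 / (1 - t 1) := by
  simp [letterRep]

/-- `r_L` has the genus-zero shape of the crux (`P = 1`, `a = 0`, `b = 0`, `c = (0,1)`). -/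
theorem isGenusZero_letterRep : IsGenusZero letterRep := by
  refine ⟨1, fun _ _ => 0, ![0, 0], ![0, 1], rfl, ?_⟩
  intro t _
  rw [letterRep_integrand]
  simp [gzIntegrand, Fin.prod_univ_two]

/-- The sub-calculus WITHOUT change of variables: moves (1a), (1b), (3). -/
def relationsWithoutCoV : AddSubgroup KZ.FormalRep :=
  AddSubgroup.closure (KZ.domainAddRel ∪ KZ.integrandAddRel ∪ KZ.newtonLeibnizRel)

/-- The sub-calculus without change of variables is part of `KZ.relations`. [folklore] -/
theorem relationsWithoutCoV_le_relations : relationsWithoutCoV ≤ KZ.relations := by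
  refine AddSubgroup.closure_mono ?_
  rintro c ((hc | hc) | hc)
  · exact Or.inl (Or.inl (Or.inl hc))
  · exact Or.inl (Or.inl (Or.inr hc))
  · exact Or.inr hc

end Summit.KontsevichZagierPeriods.DihedralNormalForm.Negative
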